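import Summits.ABC.ABC.Theses.DefiniteXi
import Summits.ABC.ABC.Theorems.DefiniteXiXiStrongBoundAllTamExp
import Literature.NumberTheory.Automorphic.BrandtEigenvectorNonEisenstein
import Literature.NumberTheory.Automorphic.BrandtEigenvectorDegreeZero
import Literature.NumberTheory.Automorphic.EichlerSubidealCount
import Literature.NumberTheory.Automorphic.BrandtXiSetupIndependence
import Literature.NumberTheory.EllipticCurves.CongruenceNumber
import Literature.NumberTheory.EllipticCurves.PastenSpectralDegreeProofs
import Literature.NumberTheory.EllipticCurves.PastenCongruenceModulusProofs
import Literature.NumberTheory.EllipticCurves.ModularDegreeMinimal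
import Literature.NumberTheory.EllipticCurves.ModularCurveManinSemistableBridgeProofs
import Literature.NumberTheory.EllipticCurves.SzpiroFreyConductorProofs
import Literature.NumberTheory.Automorphic.ShimuraCurveRibetTakahashiCokernelProofs
import Literature.NumberTheory.EllipticCurves.PastenValuationProductThm75MultiplicityProofs
import HarnessLib

/-!
# Sketch (stub-ideation k=1 · GEN 11 · FAMILY 1 RECOGNISE & IMPORT) for `stub_xiDegreeComparison`
# of crux `SteinbergCore` (stmt-ABC-15024, route-ABC-DefiniteXi, line `Lines/p6_tamagawa_split.lean`)

Companion to `STUB-IDEAS-stub_xiDegreeComparison-1.md` (gen 11).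

STATE.  The Brandt/Eichler CORE of the stub is a theorem of the crux dir:
`StubIdeasK1G10.xiCoreDivisibility : XiCoreDivisibility` (`…_1_g10_XiCoreComplete.lean`, 0 sorries).
What the registered stub still needs is k3's TAIL L3/L5/L6/L7, whose ONLY non-tree inputs are
ARS 2.1(b) (`padicValNat_congruenceNumber_eq_of_not_sq_dvd`, unproved named fact) and the route item
`FreyModularity` — both foreign to the theta-transfer mechanism: they enter solely because the stub is
typed with `cps(deg D)`, `D` minimal, while the mechanism lands on the CONGRUENCE NUMBER `r_f`.

THIS FILE (gen 11) types the import in the currency the mechanism actually produces: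

§0  `XiCoreDivisibility` (k3 g4 def, verbatim; PROVED g10).
§1  The facts-free CONGRUENCE FORM of child 1:
    `XiCongruenceComparison` := `ξ ≠ 0 → ∀ f newform of E_(a,b) at level N, cps ξ ≤ C_ε N^ε · cps(r_f)`
    and its derivation from the core: `xiCongruenceComparison_of_core` — tree lemmas only
    (L1–L2–L4 copied from k3 g4, PROVED; L3 least good prime; L5 `cps` bookkeeping; generator/guard helpers).
§2  The matching atom in the same currency: `CongruenceNumberBound` (= k2-g5 `StubIdeas2G5.CpsCongruenceBound`
    with `cps` unfolded: `cps(r_f) ≤ C_ε N^(2+ε)` for the Frey newform) and the RE-CUT GLUE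
    `steinbergCore_of_congruenceSplit : XiCongruenceComparison → CongruenceNumberBound → AbcValuationProduct →
    FreyModularity → SteinbergCore` (PROVED, pure exponent algebra; stub 3 converted by the landed
    `stub_allTamExp_of_valuationProduct`).  No ARS, no minimality, no `T³`, no Takahashi/JL/Mazur–Kenku.
§3  Back to the REGISTERED stub (Plan A): `stub_of_xiCongruenceComparison :
    XiCongruenceComparison → padicValNat_congruenceNumber_eq_of_not_sq_dvd → FreyModularity → ⟨stub verbatim⟩`
    via L6′ `primeToSix_congruenceNumber_le_primeToSix_deg` (ARS (b) at the lattice-optimal datum, `p ≥ 5`).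
-/

set_option linter.dupNamespace false
set_option autoImplicit false

noncomputable section

namespace Summit.ABC.ABC.Cruxes.SteinbergCore.StubIdeasK1G11

open scoped MatrixGroups ModularForm Matrix
open CongruenceSubgroup
open Literature.NumberTheory.EllipticCurves Literature.NumberTheory.EllipticCurves.ModularForms
open Literature.NumberTheory.Automorphic Literature.NumberTheory.Automorphic.Brandt

/-! ## §0  The core (k3 g4 def verbatim; PROVED by `StubIdeasK1G10.xiCoreDivisibility`) -/

/-- **Core divisibility** (k3 gen-4 `ProbeExtremesG4.XiCoreDivisibility`, verbatim): in a definite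
`XiSetup` of level `(N⁺, N⁻)`, for the newform `f` on `Γ₀(N⁺N⁻)` of an elliptic curve `W` whose Brandt
eigenlattice is the line `ℤφ`, every class `i` and every degree-zero `y`:
`ξ ∣ |2 w_i φ_i · ⟨φ, y⟩_w| · r_f`.  PROVED (crux dir `STUB_IDEAS_stub_xiDegreeComparison_1_g10_XiCoreComplete.lean`,
`StubIdeasK1G10.xiCoreDivisibility`, 0 sorries) — a hypothesis `hX` below only because crux workfiles are not importable. -/
def XiCoreDivisibility : Prop :=
  ∀ (Nplus Nminus M : ℕ) [NeZero M], Nplus * Nminus = M →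
    ∀ (S : XiSetup Nplus Nminus) [Fintype (ClassSet S.O)] (W : WeierstrassCurve ℚ) [W.IsElliptic]
      (f : CuspForm (Gamma0 M) 2), IsNewformOf W f →
    ∀ (φ : ClassSet S.O → ℤ), φ ≠ 0 →
      eigenLattice (Nplus * Nminus) (matrix S.O) (fun n => W.LFunction n) = ℤ ∙ φ →
    ∀ (i : ClassSet S.O) (y : ClassSet S.O → ℤ), ∑ c, y c = 0 →
      (S.xi fun n => W.LFunction n) ∣
        (2 * (weight S.O i : ℤ) * φ i * ∑ c, (weight S.O c : ℤ) * φ c * y c).natAbs *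
          congruenceNumber f

/-! ## §1a  k3 g4 L1/L1′/L1″/L4/L2 — copied verbatim (PROVED there and here) -/

theorem dvd_sub_of_forall_dvd_weight_mul_sub_of_isCoprime {ι : Type*} [Fintype ι] {R : Type*}
    [CommRing R] (T : Matrix ι ι R) (w : ι → R) {lam s : R} {v : ι → R}
    (hsymm : ∀ i j, w i * T i j = w j * T j i) (hcol : ∀ j, ∑ i, T i j = s)
    (hv : T *ᵥ v = lam • v) {m : R} {i₀ : ι} (h0 : IsCoprime m (w i₀ * v i₀))
    (hcong : ∀ i j, m ∣ w i * v i - w j * v j) : m ∣ lam - s := by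
  have heig := sum_mul_weight_mul_eq_of_mulVec_eq_smul T w hsymm hv i₀
  have key : (lam - s) * (w i₀ * v i₀) = ∑ i, T i i₀ * (w i * v i - w i₀ * v i₀) := by
    have h1 : ∑ i, T i i₀ * (w i * v i - w i₀ * v i₀) =
        ∑ i, T i i₀ * (w i * v i) - (∑ i, T i i₀) * (w i₀ * v i₀) := by
      rw [Finset.sum_mul, ← Finset.sum_sub_distrib]
      exact Finset.sum_congr rfl fun i _ => by ring
    rw [h1, heig, hcol i₀]
    ring
  have hdvd : m ∣ (lam - s) * (w i₀ * v i₀) := by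
    rw [key]
    exact Finset.dvd_sum fun i _ => Dvd.dvd.mul_left (hcong i i₀) _
  exact h0.dvd_of_dvd_mul_right hdvd

variable {Nplus Nminus : ℕ}

theorem XiSetup.dvd_sub_prime_add_one_of_forall_dvd_of_isCoprime (S : XiSetup Nplus Nminus)
    [Fintype (ClassSet S.O)] {lam : ℕ → ℤ} {v : ClassSet S.O → ℤ}
    (hv : v ∈ eigenLattice (Nplus * Nminus) (matrix S.O) lam) {m : ℤ} {c₀ : ClassSet S.O}
    (hm : IsCoprime m ((weight S.O c₀ : ℤ) * v c₀))
    (hcong : ∀ c c', m ∣ (weight S.O c : ℤ) * v c - (weight S.O c' : ℤ) * v c')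
    {ℓ : ℕ} (hℓ : ℓ.Prime) (hℓN : ¬ ℓ ∣ Nplus * Nminus) :
    m ∣ lam ℓ - (ℓ + 1) :=
  dvd_sub_of_forall_dvd_weight_mul_sub_of_isCoprime (matrix S.O ℓ) (fun c => (weight S.O c : ℤ))
    (fun i j => S.weight_mul_matrix_symm ℓ i j) (fun j => S.sum_matrix_prime_eq hℓ hℓN j)
    (hv ℓ hℓ hℓN) hm hcong

theorem XiSetup.exists_not_pow_dvd_weight_mul_sub (S : XiSetup Nplus Nminus)
    [Fintype (ClassSet S.O)] {lam : ℕ → ℤ} {v : ClassSet S.O → ℤ}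
    (hv : v ∈ eigenLattice (Nplus * Nminus) (matrix S.O) lam) {p : ℕ} (hp : p.Prime)
    (h5 : 5 ≤ p) {c₀ : ClassSet S.O} (hv0 : ¬ (p : ℤ) ∣ v c₀)
    {ℓ : ℕ} (hℓ : ℓ.Prime) (hℓN : ¬ ℓ ∣ Nplus * Nminus) {e : ℕ}
    (hne : ¬ (p : ℤ) ^ (e + 1) ∣ lam ℓ - (ℓ + 1)) :
    ∃ c c' : ClassSet S.O,
      ¬ (p : ℤ) ^ (e + 1) ∣ (weight S.O c : ℤ) * v c - (weight S.O c' : ℤ) * v c' := by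
  by_contra h
  push Not at h
  have hpZ : Prime (p : ℤ) := Nat.prime_iff_prime_int.mp hp
  have hw0 : ¬ (p : ℤ) ∣ (weight S.O c₀ : ℤ) * v c₀ := by
    intro hd
    rcases hpZ.dvd_or_dvd hd with h1 | h1
    · exact S.not_dvd_weight c₀ hp h5 (Int.natCast_dvd_natCast.mp h1)
    · exact hv0 h1
  have hcop : IsCoprime ((p : ℤ) ^ (e + 1)) ((weight S.O c₀ : ℤ) * v c₀) :=
    ((Prime.coprime_iff_not_dvd hpZ).mpr hw0).pow_left
  exact hne (XiSetup.dvd_sub_prime_add_one_of_forall_dvd_of_isCoprime S hv hcop h hℓ hℓN)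

/-- L4 (PROVED): `|a_ℓ(W) − (ℓ+1)| ≤ 4ℓ`. -/
theorem natAbs_lFunction_sub_le (W : WeierstrassCurve ℚ) [W.IsElliptic] {ℓ : ℕ} (hℓ : ℓ.Prime) :
    (((W.LFunction ℓ - (ℓ + 1)).natAbs : ℕ) : ℝ) ≤ 4 * ℓ := by
  have hb := W.abs_LFunction_prime_pow_le hℓ 1
  rw [pow_one, pow_one] at hb
  have hle : |(W.LFunction ℓ : ℝ)| ≤ 2 * Real.sqrt ℓ := by norm_num at hb ⊢; exact hb
  have hℓ1 : (1 : ℝ) ≤ ℓ := by exact_mod_cast hℓ.one_lt.le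
  have hsq : Real.sqrt ℓ ≤ ℓ := by
    calc Real.sqrt ℓ ≤ Real.sqrt ((ℓ : ℝ) ^ 2) := Real.sqrt_le_sqrt (by nlinarith)
      _ = ℓ := Real.sqrt_sq (by positivity)
  rw [Nat.cast_natAbs, Int.cast_abs]
  push_cast
  calc |(W.LFunction ℓ : ℝ) - (ℓ + 1)| ≤ |(W.LFunction ℓ : ℝ)| + |((ℓ : ℝ) + 1)| := abs_sub _ _
    _ ≤ 2 * Real.sqrt ℓ + (ℓ + 1) := by
        rw [abs_of_nonneg (by positivity : (0 : ℝ) ≤ (ℓ : ℝ) + 1)]; linarith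
    _ ≤ 4 * ℓ := by nlinarith

theorem natAbs_lFunction_sub_ne_zero (W : WeierstrassCurve ℚ) [W.IsElliptic] {ℓ : ℕ}
    (hℓ : ℓ.Prime) : (W.LFunction ℓ - (ℓ + 1)).natAbs ≠ 0 := by
  rw [ne_eq, Int.natAbs_eq_zero, sub_eq_zero]
  exact W.lFunction_ne_prime_add_one hℓ

/-- L2 (PROVED, k3 g4): core divisibility ⟹ `v_p x ≤ v_p r + v_p |a_ℓ(W) − (ℓ+1)|` (`p ≥ 5`, `ℓ ∤ N⁺N⁻`). -/
theorem factorization_le_of_core (S : XiSetup Nplus Nminus) [Fintype (ClassSet S.O)]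
    [DecidableEq (ClassSet S.O)] (W : WeierstrassCurve ℚ) [W.IsElliptic]
    {φ : ClassSet S.O → ℤ} (hφ0 : φ ≠ 0)
    (hL : eigenLattice (Nplus * Nminus) (matrix S.O) (fun n => W.LFunction n) = ℤ ∙ φ)
    {x r : ℕ} (hr : r ≠ 0)
    (hcore : ∀ (i : ClassSet S.O) (y : ClassSet S.O → ℤ), ∑ c, y c = 0 →
      x ∣ (2 * (weight S.O i : ℤ) * φ i * ∑ c, (weight S.O c : ℤ) * φ c * y c).natAbs * r)
    {p : ℕ} (hp : p.Prime) (h5 : 5 ≤ p) {ℓ : ℕ} (hℓ : ℓ.Prime) (hℓN : ¬ ℓ ∣ Nplus * Nminus) :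
    x.factorization p ≤ r.factorization p + (W.LFunction ℓ - (ℓ + 1)).natAbs.factorization p := by
  have hpZ : Prime (p : ℤ) := Nat.prime_iff_prime_int.mp hp
  have hE0 : (W.LFunction ℓ - (ℓ + 1)).natAbs ≠ 0 := natAbs_lFunction_sub_ne_zero W hℓ
  have hne : ¬ (p : ℤ) ^ ((W.LFunction ℓ - (ℓ + 1)).natAbs.factorization p + 1) ∣
      W.LFunction ℓ - (ℓ + 1) := by
    intro hd
    have hd' : p ^ ((W.LFunction ℓ - (ℓ + 1)).natAbs.factorization p + 1) ∣
        (W.LFunction ℓ - (ℓ + 1)).natAbs := Int.natCast_dvd.mp (by exact_mod_cast hd)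
    exact Nat.pow_succ_factorization_not_dvd hE0 hp hd'
  obtain ⟨c₀, hc₀⟩ := exists_not_dvd_of_eigenLattice_eq_span hφ0 hL hp
  have hφL : φ ∈ eigenLattice (Nplus * Nminus) (matrix S.O) (fun n => W.LFunction n) :=
    hL ▸ Submodule.mem_span_singleton_self φ
  obtain ⟨c, d, hcd⟩ := XiSetup.exists_not_pow_dvd_weight_mul_sub S hφL hp h5 hc₀ hℓ hℓN hne
  set δ : ℤ := (weight S.O c : ℤ) * φ c - (weight S.O d : ℤ) * φ d with hδ
  have hδ0 : δ ≠ 0 := by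
    intro h; apply hcd; rw [h]; exact dvd_zero _
  have hδe : δ.natAbs.factorization p ≤ (W.LFunction ℓ - (ℓ + 1)).natAbs.factorization p := by
    by_contra hlt
    push Not at hlt
    apply hcd
    have h1 : p ^ ((W.LFunction ℓ - (ℓ + 1)).natAbs.factorization p + 1) ∣ δ.natAbs :=
      (hp.pow_dvd_iff_le_factorization (Int.natAbs_ne_zero.mpr hδ0)).mpr hlt
    exact_mod_cast Int.natCast_dvd.mpr h1
  set y : ClassSet S.O → ℤ := Pi.single c 1 - Pi.single d 1 with hy
  have hy0 : ∑ i, y i = 0 := by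
    simp only [hy, Pi.sub_apply, Pi.single_apply, Finset.sum_sub_distrib, Finset.sum_ite_eq',
      Finset.mem_univ, if_true, sub_self]
  have hpair : ∑ i, (weight S.O i : ℤ) * φ i * y i = δ := by
    simp only [hy, hδ, Pi.sub_apply, Pi.single_apply, mul_sub, mul_ite, mul_one, mul_zero,
      Finset.sum_sub_distrib, Finset.sum_ite_eq', Finset.mem_univ, if_true]
  have hdiv := hcore c₀ y hy0
  rw [hpair, Int.natAbs_mul, mul_assoc] at hdiv
  have hA : ¬ p ∣ (2 * (weight S.O c₀ : ℤ) * φ c₀).natAbs := by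
    intro hd
    have hd' : (p : ℤ) ∣ 2 * (weight S.O c₀ : ℤ) * φ c₀ := Int.natCast_dvd.mpr hd
    rcases hpZ.dvd_or_dvd hd' with h2 | h2
    · rcases hpZ.dvd_or_dvd h2 with h3 | h3
      · have h4 : p ∣ 2 := by exact_mod_cast h3
        have := Nat.le_of_dvd two_pos h4
        omega
      · exact S.not_dvd_weight c₀ hp h5 (Int.natCast_dvd_natCast.mp h3)
    · exact hc₀ h2
  have h1 : p ^ x.factorization p ∣ δ.natAbs * r :=
    (Nat.Coprime.pow_left _ ((Nat.Prime.coprime_iff_not_dvd hp).mpr hA)).dvd_of_dvd_mul_left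
      ((Nat.ordProj_dvd x p).trans hdiv)
  have hδr : δ.natAbs * r ≠ 0 := mul_ne_zero (Int.natAbs_ne_zero.mpr hδ0) hr
  have h2 := (hp.pow_dvd_iff_le_factorization hδr).mp h1
  rw [Nat.factorization_mul (Int.natAbs_ne_zero.mpr hδ0) hr, Finsupp.add_apply] at h2
  omega

/-! ## §1b  The small helpers of the tail (each ≤ one prover cycle) -/

/-- **L3 — the least good prime is `N^{o(1)}` (XS, PROVED; where `ε` is spent).**  Tree:
`ModularForms.exists_prime_not_dvd_le_log` (Chebyshev: `ℓ ∤ N`, `ℓ ≤ 2 log N + C`), then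
`log N ≤ N^ε/ε` (`Real.log_le_sub_one_of_pos` at `N^ε`). -/
theorem exists_prime_not_dvd_le_rpow {ε : ℝ} (hε : 0 < ε) :
    ∃ C : ℝ, 0 < C ∧ ∀ N : ℕ, 1 ≤ N → ∃ ℓ : ℕ, ℓ.Prime ∧ ¬ ℓ ∣ N ∧ (ℓ : ℝ) ≤ C * (N : ℝ) ^ ε := by
  obtain ⟨C, hC⟩ := exists_prime_not_dvd_le_log
  refine ⟨2 / ε + max C 0, by positivity, fun N hN => ?_⟩
  obtain ⟨ℓ, hℓ, hℓN, hle⟩ := hC N (by omega)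
  refine ⟨ℓ, hℓ, hℓN, hle.trans ?_⟩
  have hNpos : (0 : ℝ) < (N : ℝ) := by exact_mod_cast hN
  have hN1 : (1 : ℝ) ≤ (N : ℝ) := by exact_mod_cast hN
  have h1 : (1 : ℝ) ≤ (N : ℝ) ^ ε := Real.one_le_rpow hN1 hε.le
  have hlog : Real.log N ≤ (N : ℝ) ^ ε / ε := by
    have h2 : Real.log ((N : ℝ) ^ ε) ≤ (N : ℝ) ^ ε - 1 :=
      Real.log_le_sub_one_of_pos (Real.rpow_pos_of_pos hNpos ε)
    rw [Real.log_rpow hNpos] at h2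
    rw [le_div_iff₀ hε]
    linarith
  have hC0 : C ≤ max C 0 * (N : ℝ) ^ ε :=
    (le_max_left C 0).trans (le_mul_of_one_le_right (le_max_right _ _) h1)
  calc 2 * Real.log N + C ≤ 2 * ((N : ℝ) ^ ε / ε) + max C 0 * (N : ℝ) ^ ε :=
        add_le_add (mul_le_mul_of_nonneg_left hlog zero_le_two) hC0
    _ = (2 / ε + max C 0) * (N : ℝ) ^ ε := by ring

/-- `2^{v₂ n} 3^{v₃ n} ∣ n`. -/
theorem ordProj_two_mul_ordProj_three_dvd (n : ℕ) : ordProj[2] n * ordProj[3] n ∣ n :=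
  Nat.Coprime.mul_dvd_of_dvd_of_dvd (Nat.Coprime.pow _ _ (by norm_num)) (Nat.ordProj_dvd n 2)
    (Nat.ordProj_dvd n 3)

theorem primeToSix_ne_zero {n : ℕ} (hn : n ≠ 0) : n / (ordProj[2] n * ordProj[3] n) ≠ 0 :=
  (Nat.div_pos (Nat.le_of_dvd (Nat.pos_of_ne_zero hn) (ordProj_two_mul_ordProj_three_dvd n))
    (Nat.pos_of_ne_zero (mul_ne_zero (pow_ne_zero _ two_ne_zero) (pow_ne_zero _ three_ne_zero)))).ne'

/-- The valuations of `cps n = n / (2^{v₂ n} 3^{v₃ n})`: `0` at `2, 3`, those of `n` elsewhere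
(self-contained; cf. `SteinbergCore.Negative.primeToSix_eq_ordCompl`). -/
theorem factorization_primeToSix (n q : ℕ) :
    (n / (ordProj[2] n * ordProj[3] n)).factorization q =
      if q = 2 ∨ q = 3 then 0 else n.factorization q := by
  rw [Nat.factorization_div (ordProj_two_mul_ordProj_three_dvd n), Finsupp.tsub_apply,
    Nat.factorization_mul (pow_ne_zero _ two_ne_zero) (pow_ne_zero _ three_ne_zero),
    Finsupp.add_apply, Nat.prime_two.factorization_pow, Nat.prime_three.factorization_pow,
    Finsupp.single_apply, Finsupp.single_apply]
  by_cases h2 : q = 2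
  · subst h2; simp
  · by_cases h3 : q = 3
    · subst h3; simp
    · simp [h2, h3, Ne.symm h2, Ne.symm h3]

/-- **L5 — `cps` bookkeeping (XS, PROVED, self-contained).**  `v_p x ≤ v_p r + v_p e` for all primes
`p ≥ 5` (`r, e ≠ 0`) gives `cps x ∣ cps r · e`, hence `cps x ≤ cps r · e`. -/
theorem primeToSix_le_mul_of_factorization_le {x r e : ℕ} (hr : r ≠ 0) (he : e ≠ 0)
    (h : ∀ p : ℕ, p.Prime → 5 ≤ p → x.factorization p ≤ r.factorization p + e.factorization p) :
    x / (ordProj[2] x * ordProj[3] x) ≤ r / (ordProj[2] r * ordProj[3] r) * e := by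
  rcases eq_or_ne x 0 with rfl | hx
  · simp
  have hcx := primeToSix_ne_zero hx
  have hcre : r / (ordProj[2] r * ordProj[3] r) * e ≠ 0 := mul_ne_zero (primeToSix_ne_zero hr) he
  refine Nat.le_of_dvd (Nat.pos_of_ne_zero hcre) ((Nat.factorization_le_iff_dvd hcx hcre).mp ?_)
  rw [Nat.factorization_mul (primeToSix_ne_zero hr) he]
  refine Finsupp.le_def.mpr fun q => ?_
  rw [Finsupp.add_apply, factorization_primeToSix, factorization_primeToSix]
  by_cases h23 : q = 2 ∨ q = 3
  · simp [h23]
  · rw [if_neg h23, if_neg h23]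
    by_cases hq : q.Prime
    · have h4 : q ≠ 4 := by rintro rfl; exact absurd hq (by decide)
      have h2q := hq.two_le
      push Not at h23
      exact h q hq (by omega)
    · simp [Nat.factorization_eq_zero_of_not_prime _ hq]

/-- **Generator helper (XS, PROVED).**  `brandtXi ≠ 0` ⟹ a setup `S` exists and, for any `Fintype`
structure on its class set, the eigen-lattice is a line `ℤφ` with `brandtXi = Σ_i w_i φ_i²`
(`XiSetup.brandtXi_eq_xi` — setup independence, PROVED in the tree; `xiOfOrder_eq`; `xi_eq_sum`;
contrapositive of `xi_of_not_isLine`; `brandtXi_of_isEmpty`). -/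
theorem exists_generator_of_brandtXi_ne_zero {lam : ℕ → ℤ} (h : brandtXi Nplus Nminus lam ≠ 0) :
    ∃ S : XiSetup Nplus Nminus, ∀ [Fintype (ClassSet S.O)],
      ∃ φ : ClassSet S.O → ℤ, φ ≠ 0 ∧ eigenLattice (Nplus * Nminus) (matrix S.O) lam = ℤ ∙ φ ∧
        brandtXi Nplus Nminus lam = ∑ i, weight S.O i * (φ i).natAbs ^ 2 := by
  by_cases hne : Nonempty (XiSetup Nplus Nminus)
  · obtain ⟨S⟩ := hne
    refine ⟨S, ?_⟩
    intro _inst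
    have hxi : brandtXi Nplus Nminus lam =
        xi (weight S.O) (eigenLattice (Nplus * Nminus) (matrix S.O) lam) := by
      rw [S.brandtXi_eq_xi, XiSetup.xi, xiOfOrder_eq]
    by_cases hline : ∃ φ : ClassSet S.O → ℤ, φ ≠ 0 ∧
        eigenLattice (Nplus * Nminus) (matrix S.O) lam = ℤ ∙ φ
    · obtain ⟨φ, hφ, hL⟩ := hline
      exact ⟨φ, hφ, hL, by rw [hxi, xi_eq_sum _ hφ hL]⟩
    · exact absurd (by rw [hxi]; exact xi_of_not_isLine _ hline) h
  · exact absurd (brandtXi_of_isEmpty (not_nonempty_iff.mp hne) lam) h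

/-- **Guard (XS).**  The congruence number of the newform of an elliptic curve is `≠ 0`
(`r_f ∣ ∏_{P ≠ 𝕀_f} η_f(P) ≠ 0`, Pasten–Shimura §5.6; tree `congruenceNumber_dvd_prod_heckeCongruenceModulus`,
`heckeCongruenceModulus_ne_zero` — the datum-free port of k2's `congruenceNumber_ne_zero`; the three inputs
`f ≠ 0`, `HasIntegralEigenvalues f`, `f ∈ S₂(Γ₀(N);ℤ)` are the proofs of `D.f_ne_zero`,
`D.hasIntegralEigenvalues_f`, `D.f_mem_integralCuspForms0` with `D.isNewformOf ↦ hf`). -/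
theorem congruenceNumber_ne_zero_of_isNewformOf {N : ℕ} [NeZero N] {W : WeierstrassCurve ℚ}
    {f : CuspForm (Gamma0 N) 2} (hf : IsNewformOf W f) : congruenceNumber f ≠ 0 := by
  have hf0 : f ≠ 0 := by
    intro h
    have h1 : (UpperHalfPlane.qExpansion 1 ⇑f).coeff 1 = 1 := hf.1.2.2
    rw [h, CuspForm.coe_zero, UpperHalfPlane.qExpansion_zero, map_zero] at h1
    exact zero_ne_one h1
  have hInt : HasIntegralEigenvalues f := by
    intro p hp _
    haveI : NeZero p := ⟨hp.ne_zero⟩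
    obtain ⟨hnew, hcoeff⟩ := hf
    have heig := heckeT_eq_heckeEigenvalue_smul f p (hnew.2.1 p hp)
    have h1 := qExpansion_coeff_heckeT_holds N 2 f p hp 1
    have hcoe : ⇑(heckeT (Gamma0 N) 2 p f) = heckeEigenvalue f p • ⇑f := by
      rw [heig]; rfl
    have hnorm : (UpperHalfPlane.qExpansion 1 ⇑f).coeff 1 = 1 := hnew.2.2
    rw [hcoe, ModularForm.qExpansion_smul one_pos (one_mem_strictPeriods_gamma0 N) _ f, map_smul,
      smul_eq_mul, hnorm, mul_one, mul_one, if_neg (Nat.Prime.not_dvd_one hp), mul_zero,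
      ite_self, add_zero] at h1
    refine ⟨W.LFunction p, ?_⟩
    rw [heig, h1]
    exact congrArg (· • f) (hcoeff p)
  have hfL : f ∈ integralCuspForms0 N 2 := fun n ↦ ⟨W.LFunction n, (hf.2 n).symm⟩
  intro h0
  have hdvd := congruenceNumber_dvd_prod_heckeCongruenceModulus hf.1 hInt hfL
  rw [h0, zero_dvd_iff, Finset.prod_eq_zero_iff] at hdvd
  obtain ⟨P, hP, hP0⟩ := hdvd
  exact heckeCongruenceModulus_ne_zero hInt hf0
    ((finite_minimalPrimes_anemicHeckeRing N 2).mem_toFinset.mp (Finset.mem_of_mem_erase hP))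
    (Finset.ne_of_mem_erase hP) hP0

/-! ## §1c  CHILD 1 IN CONGRUENCE CURRENCY — facts-free -/

/-- **`XiCongruenceComparison` (child 1♮, the facts-free re-cut of `stub_xiDegreeComparison`).**
For coprime `a, b` (`ab(a+b) ≠ 0`), `N = N(E_(a,b))`, admissible `Nm`, `ξ = ξ(E; N/Nm, Nm) ≠ 0` and EVERY
newform `f` of `E_(a,b)` at level `N`:  `cps ξ ≤ C_ε · N^ε · cps(r_f)`.
No datum, no minimality, no Tamagawa exponents, no ARS, no modularity (vacuous where no newform exists).
[mechanism: theta-lattice congruence transfer, k1/k2/k3 gens 3–10] -/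
def XiCongruenceComparison : Prop :=
  ∀ ε : ℝ, 0 < ε → ∃ C : ℝ, ∀ a b : ℤ, IsCoprime a b → a * b * (a + b) ≠ 0 → ∀ (N : ℕ) [NeZero N],
    (freyCurve a b).conductorNorm ℤ = N →
    ∀ Nm : ℕ, Odd Nm → Squarefree Nm → Odd Nm.primeFactors.card → Nm ∣ N →
    brandtXi (N / Nm) Nm (fun n => (freyCurve a b).LFunction n) ≠ 0 →
    ∀ f : CuspForm (Gamma0 N) 2, IsNewformOf (freyCurve a b) f →
      ((brandtXi (N / Nm) Nm (fun n => (freyCurve a b).LFunction n) /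
          (ordProj[2] (brandtXi (N / Nm) Nm (fun n => (freyCurve a b).LFunction n)) *
            ordProj[3] (brandtXi (N / Nm) Nm (fun n => (freyCurve a b).LFunction n))) : ℕ) : ℝ) ≤
        C * (N : ℝ) ^ ε *
          ((congruenceNumber f / (ordProj[2] (congruenceNumber f) * ordProj[3] (congruenceNumber f)) : ℕ) : ℝ)

/-- **L7♮ — child 1♮ from the core (S · assembly; NO named fact).**  `C := 4 C₃` (L3).  Given the data and
`ξ ≠ 0`: generator `φ` of the chosen setup `S` (`exists_generator_of_brandtXi_ne_zero`), `r_f ≠ 0` (guard),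
`ℓ ∤ N = (N/Nm)·Nm` with `ℓ ≤ C₃ N^ε` (L3); L2 with `hcore := hX (N/Nm) Nm N _ S (freyCurve a b) f hf φ …`
(`S.xi = brandtXi` by `XiSetup.brandtXi_eq_xi`) gives `v_p ξ ≤ v_p r_f + v_p|a_ℓ − ℓ − 1|` for `p ≥ 5`;
L5 + L4: `cps ξ ≤ cps r_f · |a_ℓ − ℓ − 1| ≤ cps r_f · 4ℓ ≤ 4 C₃ N^ε cps r_f`. -/
theorem xiCongruenceComparison_of_core (hX : XiCoreDivisibility) : XiCongruenceComparison := by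
  intro ε hε
  obtain ⟨C₃, -, hC₃⟩ := exists_prime_not_dvd_le_rpow hε
  refine ⟨4 * C₃, fun a b hab h0 N _ hN Nm hodd hsq hcard hNmN hξ f hf => ?_⟩
  classical
  haveI := isElliptic_freyCurve h0
  obtain ⟨S, hS⟩ := exists_generator_of_brandtXi_ne_zero hξ
  letI : Fintype (ClassSet S.O) := Fintype.ofFinite _
  obtain ⟨φ, hφ0, hL, -⟩ := hS
  have hN' : N / Nm * Nm = N := Nat.div_mul_cancel hNmN
  have hr : congruenceNumber f ≠ 0 := congruenceNumber_ne_zero_of_isNewformOf hf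
  obtain ⟨ℓ, hℓ, hℓN, hℓle⟩ := hC₃ N (Nat.pos_of_ne_zero (NeZero.ne N))
  have hℓN' : ¬ ℓ ∣ N / Nm * Nm := by rwa [hN']
  have hcore := hX (N / Nm) Nm N hN' S (freyCurve a b) f hf φ hφ0 hL
  have hxS : S.xi (fun n => (freyCurve a b).LFunction n) =
      brandtXi (N / Nm) Nm (fun n => (freyCurve a b).LFunction n) := (S.brandtXi_eq_xi _).symm
  set ξ : ℕ := brandtXi (N / Nm) Nm (fun n => (freyCurve a b).LFunction n) with hξdef
  set r : ℕ := congruenceNumber f with hrdef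
  set e : ℕ := ((freyCurve a b).LFunction ℓ - (ℓ + 1)).natAbs with hedef
  have he : e ≠ 0 := natAbs_lFunction_sub_ne_zero (freyCurve a b) hℓ
  have hval : ∀ p : ℕ, p.Prime → 5 ≤ p →
      ξ.factorization p ≤ r.factorization p + e.factorization p := by
    intro p hp h5
    refine factorization_le_of_core S (freyCurve a b) hφ0 hL hr (x := ξ) ?_ hp h5 hℓ hℓN'
    intro i y hy
    have h := hcore i y hy
    rwa [hxS] at h
  have hL5 := primeToSix_le_mul_of_factorization_le hr he hval
  have hL4 : (e : ℝ) ≤ 4 * ℓ := natAbs_lFunction_sub_le (freyCurve a b) hℓ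
  have hcr0 : (0 : ℝ) ≤ ((r / (ordProj[2] r * ordProj[3] r) : ℕ) : ℝ) := Nat.cast_nonneg _
  calc ((ξ / (ordProj[2] ξ * ordProj[3] ξ) : ℕ) : ℝ)
      ≤ ((r / (ordProj[2] r * ordProj[3] r) * e : ℕ) : ℝ) := by exact_mod_cast hL5
    _ = ((r / (ordProj[2] r * ordProj[3] r) : ℕ) : ℝ) * (e : ℝ) := by rw [Nat.cast_mul]
    _ ≤ ((r / (ordProj[2] r * ordProj[3] r) : ℕ) : ℝ) * (4 * ℓ) := mul_le_mul_of_nonneg_left hL4 hcr0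
    _ ≤ ((r / (ordProj[2] r * ordProj[3] r) : ℕ) : ℝ) * (4 * (C₃ * (N : ℝ) ^ ε)) := by gcongr
    _ = 4 * C₃ * (N : ℝ) ^ ε * ((r / (ordProj[2] r * ordProj[3] r) : ℕ) : ℝ) := by ring

/-! ## §2  The atom in the same currency and the RE-CUT GLUE (PROVED) -/

/-- **`CongruenceNumberBound` (child 2♮; = k2 gen-5 `StubIdeas2G5.CpsCongruenceBound`, `cps` unfolded).**
The prime-to-6 part of the congruence number of the Frey newform is `≤ C_ε N^(2+ε)`.  abc-STRENGTH ATOM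
(⟺ `stub_primeToSixDegreeBound` modulo ARS 2.1(a)(b) + optimal-quotient transport, k2 g5 H8a/H8b);
data-free — a statement about `S₂(Γ₀(N); ℤ)` and one `q`-expansion; first tree rung
`r_f ∣ ∏_{P ≠ 𝕀_f} η_f(P)` (Pasten–Shimura Thm 5.5, PROVED), ceiling `log r_f ≤ (1/5) N log N` (Murty–Pasten, PROVED). -/
def CongruenceNumberBound : Prop :=
  ∀ ε : ℝ, 0 < ε → ∃ C : ℝ, ∀ a b : ℤ, IsCoprime a b → a * b * (a + b) ≠ 0 → ∀ (N : ℕ) [NeZero N],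
    (freyCurve a b).conductorNorm ℤ = N →
    ∀ f : CuspForm (Gamma0 N) 2, IsNewformOf (freyCurve a b) f →
      ((congruenceNumber f / (ordProj[2] (congruenceNumber f) * ordProj[3] (congruenceNumber f)) : ℕ) : ℝ) ≤
        C * (N : ℝ) ^ (2 + ε)

/-- **RE-CUT GLUE (PROVED).**  `XiCongruenceComparison → CongruenceNumberBound → AbcValuationProduct (stub 3
verbatim) → FreyModularity → SteinbergCore`:  at `ξ = 0` the left side is `0`; otherwise `FreyModularity`
gives a datum `D`, `f := D.f`, and `cps ξ · T ≤ C₀ N^{ε/3} cps(r_f) · T ≤ C₀ N^{ε/3} · C₁ N^{2+ε/3} · C₂ N^{ε/3}`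
(`stub_allTamExp_of_valuationProduct` for `T ≤ C₂ N^{ε/3}`). -/
theorem steinbergCore_of_congruenceSplit (h1 : XiCongruenceComparison) (h2 : CongruenceNumberBound)
    (h3 : ∀ ε : ℝ, 0 < ε → ∃ K : ℝ, ∀ a b c : ℕ, Literature.NumberTheory.DiophantineGeometry.IsABCTriple a b c →
      ((∏ p ∈ (a * b * c).primeFactors, (a * b * c).factorization p : ℕ) : ℝ) ≤
        K * ((Literature.NumberTheory.DiophantineGeometry.rad a b c : ℕ) : ℝ) ^ ε)
    (hMod : Summit.ABC.ABC.Theses.DefiniteXi.FreyModularity) :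
    Summit.ABC.ABC.Theses.DefiniteXi.SteinbergCore := by
  intro ε hε
  obtain ⟨C₀, hC₀⟩ := h1 (ε / 3) (by linarith)
  obtain ⟨C₁, hC₁⟩ := h2 (ε / 3) (by linarith)
  obtain ⟨C₂, hC₂⟩ := Summit.ABC.ABC.Theorems.stub_allTamExp_of_valuationProduct h3 (ε / 3) (by linarith)
  refine ⟨max C₀ 0 * max C₁ 0 * max C₂ 0, ?_⟩
  intro a b hab h0 N _ hN Nm hodd hsq hcard hdvd
  have hNpos : (0 : ℝ) < (N : ℝ) := by exact_mod_cast Nat.pos_of_ne_zero (NeZero.ne N)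
  set ξ : ℕ := brandtXi (N / Nm) Nm (fun n => (freyCurve a b).LFunction n) with hξ
  set T : ℕ := ∏ q ∈ N.primeFactors, ((freyCurve a b).minimalDiscriminantNorm ℤ).factorization q with hTdef
  have hsplit : (N : ℝ) ^ (ε / 3) * (N : ℝ) ^ (2 + ε / 3) * (N : ℝ) ^ (ε / 3) = (N : ℝ) ^ (2 + ε) := by
    rw [← Real.rpow_add hNpos, ← Real.rpow_add hNpos]
    ring_nf
  have hRHS0 : (0 : ℝ) ≤ max C₀ 0 * max C₁ 0 * max C₂ 0 * (N : ℝ) ^ (2 + ε) := by positivity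
  have hT0 : (0 : ℝ) ≤ (T : ℝ) := by positivity
  have hTle : (T : ℝ) ≤ max C₂ 0 * (N : ℝ) ^ (ε / 3) :=
    (hC₂ a b hab h0 N hN).trans (mul_le_mul_of_nonneg_right (le_max_left _ _) (by positivity))
  by_cases hξ0 : ξ = 0
  · have : ξ / (ordProj[2] ξ * ordProj[3] ξ) = 0 := by rw [hξ0, Nat.zero_div]
    rw [this]
    simpa using hRHS0
  · obtain ⟨D⟩ := hMod a b hab h0 N hN
    set r : ℕ := congruenceNumber D.f with hr
    have h1' : ((ξ / (ordProj[2] ξ * ordProj[3] ξ) : ℕ) : ℝ) ≤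
        max C₀ 0 * (N : ℝ) ^ (ε / 3) * ((r / (ordProj[2] r * ordProj[3] r) : ℕ) : ℝ) := by
      refine (hC₀ a b hab h0 N hN Nm hodd hsq hcard hdvd hξ0 D.f D.isNewformOf).trans ?_
      have h0' : (0 : ℝ) ≤ (N : ℝ) ^ (ε / 3) * ((r / (ordProj[2] r * ordProj[3] r) : ℕ) : ℝ) := by positivity
      calc C₀ * (N : ℝ) ^ (ε / 3) * ((r / (ordProj[2] r * ordProj[3] r) : ℕ) : ℝ)
          = C₀ * ((N : ℝ) ^ (ε / 3) * ((r / (ordProj[2] r * ordProj[3] r) : ℕ) : ℝ)) := by ring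
        _ ≤ max C₀ 0 * ((N : ℝ) ^ (ε / 3) * ((r / (ordProj[2] r * ordProj[3] r) : ℕ) : ℝ)) :=
            mul_le_mul_of_nonneg_right (le_max_left _ _) h0'
        _ = _ := by ring
    have h2' : ((r / (ordProj[2] r * ordProj[3] r) : ℕ) : ℝ) ≤ max C₁ 0 * (N : ℝ) ^ (2 + ε / 3) :=
      (hC₁ a b hab h0 N hN D.f D.isNewformOf).trans
        (mul_le_mul_of_nonneg_right (le_max_left _ _) (by positivity))
    calc ((ξ / (ordProj[2] ξ * ordProj[3] ξ) : ℕ) : ℝ) * (T : ℝ)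
        ≤ (max C₀ 0 * (N : ℝ) ^ (ε / 3) * ((r / (ordProj[2] r * ordProj[3] r) : ℕ) : ℝ)) *
            (max C₂ 0 * (N : ℝ) ^ (ε / 3)) := mul_le_mul h1' hTle hT0 (by positivity)
      _ ≤ (max C₀ 0 * (N : ℝ) ^ (ε / 3) * (max C₁ 0 * (N : ℝ) ^ (2 + ε / 3))) *
            (max C₂ 0 * (N : ℝ) ^ (ε / 3)) := by gcongr
      _ = max C₀ 0 * max C₁ 0 * max C₂ 0 *
            ((N : ℝ) ^ (ε / 3) * (N : ℝ) ^ (2 + ε / 3) * (N : ℝ) ^ (ε / 3)) := by ring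
      _ = max C₀ 0 * max C₁ 0 * max C₂ 0 * (N : ℝ) ^ (2 + ε) := by rw [hsplit]

/-! ## §3  Back to the REGISTERED stub (Plan A: the two foreign inputs, named) -/

/-- `q² ∤ N(E_(a,b))` at every odd prime `q` (`N ∣ 2⁸ rad(ab(a+b))`, radical squarefree; copy of
`XiBound.Negative.not_sq_dvd_conductorNorm_freyCurve`). -/
theorem not_sq_dvd_conductorNorm_freyCurve_of_ne_two {a b : ℤ} (hab : IsCoprime a b)
    (h0 : a * b * (a + b) ≠ 0) {q : ℕ} (hq : q.Prime) (hq2 : q ≠ 2) :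
    ¬ q ^ 2 ∣ (freyCurve a b).conductorNorm ℤ := by
  intro hq2N
  have h' : q ^ 2 ∣ 2 ^ 8 * (UniqueFactorizationMonoid.radical (a * b * (a + b))).natAbs :=
    hq2N.trans (conductorNorm_freyCurve_dvd_holds a b hab h0)
  have hcop : Nat.Coprime (q ^ 2) (2 ^ 8) :=
    Nat.Coprime.pow _ _ ((Nat.coprime_primes hq Nat.prime_two).mpr hq2)
  have hr : q ^ 2 ∣ (UniqueFactorizationMonoid.radical (a * b * (a + b))).natAbs :=
    hcop.dvd_of_dvd_mul_left h'
  have hsq : Squarefree (UniqueFactorizationMonoid.radical (a * b * (a + b))).natAbs :=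
    Int.squarefree_natAbs.mpr UniqueFactorizationMonoid.squarefree_radical
  have hu : IsUnit (q : ℕ) := hsq q ((pow_two q) ▸ hr)
  exact hq.ne_one (Nat.isUnit_iff.mp hu)

/-- `cps m ≤ cps n` for `m ∣ n ≠ 0` (self-contained; cf. `XiDegreeComparison.primeToSix_le_of_dvd`). -/
theorem primeToSix_le_of_dvd' {m n : ℕ} (h : m ∣ n) (hn : n ≠ 0) :
    m / (ordProj[2] m * ordProj[3] m) ≤ n / (ordProj[2] n * ordProj[3] n) := by
  have hm : m ≠ 0 := ne_zero_of_dvd_ne_zero hn h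
  have hle := Finsupp.le_def.mp ((Nat.factorization_le_iff_dvd hm hn).mpr h)
  have := primeToSix_le_mul_of_factorization_le (x := m) hn one_ne_zero
    (fun p _ _ => by simpa using hle p)
  simpa using this

/-- **L6′ (S, PROVED from the named fact; the ONLY place ARS enters).**  For the Frey curve and ANY datum `D` at its conductor:
`cps(r_{D.f}) ≤ cps(deg D)`.  Route: `D₀ := D.exists_optimalDatum'` (same newform, `ker = ⊥`, minimal among
same-newform data by `modularDegree_le_of_isogenyMap_ker_eq_bot`), `deg D₀ ∣ deg D` (`modularDegree_eq_card_ker_mul`,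
template p139336 :286–299), ARS (b) at `D₀` for every prime `p ≥ 5` (`p² ∤ N`: `N ∣ 2⁸ rad`,
`conductorNorm_freyCurve_dvd_holds`, `Nat.squarefree_radical`-type step) gives `v_p r_f = v_p deg D₀`; then L5-type
bookkeeping (`e = 1`) and `primeToSix_le_of_dvd`. [cite: AgasheRibetStein2012, Thm. 2.1] -/
theorem primeToSix_congruenceNumber_le_primeToSix_deg (hARS : padicValNat_congruenceNumber_eq_of_not_sq_dvd)
    {a b : ℤ} (hab : IsCoprime a b) (h0 : a * b * (a + b) ≠ 0) {N : ℕ} [NeZero N]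
    (hN : (freyCurve a b).conductorNorm ℤ = N) (D : ModularParametrizationData (freyCurve a b) N) :
    congruenceNumber D.f / (ordProj[2] (congruenceNumber D.f) * ordProj[3] (congruenceNumber D.f)) ≤
      D.deg / (ordProj[2] D.deg * ordProj[3] D.deg) := by
  haveI := isElliptic_freyCurve h0
  obtain ⟨W₀, hW₀, D₀, hf₀, h₀⟩ := D.exists_optimalDatum'
  haveI := hW₀
  have hker₀ : D₀.isogenyMap.ker = ⊥ := D₀.isogenyMap_ker_eq_bot_iff.mpr h₀
  have hmin₀ : ∀ (W₂ : WeierstrassCurve ℚ) [W₂.IsElliptic] (D₂ : ModularParametrizationData W₂ N),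
      D₂.f = D₀.f → D₀.modularDegree ≤ D₂.modularDegree := fun W₂ _ D₂ hD₂ =>
    D₀.modularDegree_le_of_isogenyMap_ker_eq_bot hker₀ D₂ hD₂
  have hdvd : D₀.modularDegree ∣ D.deg := by
    have hinj : Function.Injective D₀.isogenyMap := (AddMonoidHom.ker_eq_bot_iff _).mp hker₀
    obtain ⟨_, hdeg⟩ := D.modularDegree_eq_card_ker_mul hf₀.symm D₀.smul_periodLattice_le hinj
      D₀.deg_pos D₀.finite_setOf_natCard_fiberOrbits_ne
    exact ⟨_, hdeg.trans (mul_comm _ _)⟩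
  have hd0 : D₀.modularDegree ≠ 0 := D₀.deg_pos.ne'
  have hval : ∀ p : ℕ, p.Prime → 5 ≤ p → (congruenceNumber D.f).factorization p ≤
      D₀.modularDegree.factorization p + (1 : ℕ).factorization p := by
    intro p hp h5
    have hsq : ¬ p ^ 2 ∣ N := by
      have h := not_sq_dvd_conductorNorm_freyCurve_of_ne_two hab h0 hp (by omega)
      rwa [hN] at h
    have h := hARS W₀ N D₀ hmin₀ p hp hsq
    rw [hf₀, ← Nat.factorization_def _ hp, ← Nat.factorization_def _ hp] at h
    simp [h]
  calc congruenceNumber D.f / (ordProj[2] (congruenceNumber D.f) * ordProj[3] (congruenceNumber D.f))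
      ≤ D₀.modularDegree / (ordProj[2] D₀.modularDegree * ordProj[3] D₀.modularDegree) * 1 :=
        primeToSix_le_mul_of_factorization_le hd0 one_ne_zero hval
    _ = D₀.modularDegree / (ordProj[2] D₀.modularDegree * ordProj[3] D₀.modularDegree) := mul_one _
    _ ≤ D.deg / (ordProj[2] D.deg * ordProj[3] D.deg) := primeToSix_le_of_dvd' hdvd D.deg_pos.ne'

/-- **Plan A assembly (PROVED from child 1♮ + L6′): the REGISTERED stub, verbatim, from
`XiCongruenceComparison`, ARS 2.1(b) and `FreyModularity`.**  `D` := a minimal datum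
(`exists_minimal_datum (hMod …)`), child 1♮ at `f := D.f`, L6′, and `1 ≤ T³`. -/
theorem stub_of_xiCongruenceComparison (h1 : XiCongruenceComparison)
    (hARS : padicValNat_congruenceNumber_eq_of_not_sq_dvd)
    (hMod : Summit.ABC.ABC.Theses.DefiniteXi.FreyModularity) :
    ∀ ε : ℝ, 0 < ε → ∃ C : ℝ, ∀ a b : ℤ, IsCoprime a b → a * b * (a + b) ≠ 0 → ∀ (N : ℕ) [NeZero N],
      (Literature.NumberTheory.EllipticCurves.freyCurve a b).conductorNorm ℤ = N →
      ∀ Nm : ℕ, Odd Nm → Squarefree Nm → Odd Nm.primeFactors.card → Nm ∣ N →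
      Literature.NumberTheory.Automorphic.brandtXi (N / Nm) Nm
          (fun n => (Literature.NumberTheory.EllipticCurves.freyCurve a b).LFunction n) ≠ 0 →
      ∃ D : Literature.NumberTheory.EllipticCurves.ModularForms.ModularParametrizationData
        (Literature.NumberTheory.EllipticCurves.freyCurve a b) N,
        (∀ D' : Literature.NumberTheory.EllipticCurves.ModularForms.ModularParametrizationData
          (Literature.NumberTheory.EllipticCurves.freyCurve a b) N, D.deg ≤ D'.deg) ∧
        ((Literature.NumberTheory.Automorphic.brandtXi (N / Nm) Nm
              (fun n => (Literature.NumberTheory.EllipticCurves.freyCurve a b).LFunction n) /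
            (ordProj[2] (Literature.NumberTheory.Automorphic.brandtXi (N / Nm) Nm
                (fun n => (Literature.NumberTheory.EllipticCurves.freyCurve a b).LFunction n)) *
              ordProj[3] (Literature.NumberTheory.Automorphic.brandtXi (N / Nm) Nm
                (fun n => (Literature.NumberTheory.EllipticCurves.freyCurve a b).LFunction n))) : ℕ) : ℝ) ≤
          C * (N : ℝ) ^ ε * ((D.deg / (ordProj[2] D.deg * ordProj[3] D.deg) : ℕ) : ℝ) *
            ((∏ q ∈ N.primeFactors, ((Literature.NumberTheory.EllipticCurves.freyCurve a b).minimalDiscriminantNorm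
              ℤ).factorization q : ℕ) : ℝ) ^ 3 := by
  intro ε hε
  obtain ⟨C, hC⟩ := h1 ε hε
  refine ⟨max C 0, fun a b hab h0 N _ hN Nm hodd hsq hcard hNmN hξ => ?_⟩
  haveI := isElliptic_freyCurve h0
  obtain ⟨D, -, hDmin⟩ := exists_minimal_datum (hMod a b hab h0 N hN)
  refine ⟨D, fun D' => hDmin D', ?_⟩
  set ξ : ℕ := brandtXi (N / Nm) Nm (fun n => (freyCurve a b).LFunction n) with hξdef
  set T : ℕ := ∏ q ∈ N.primeFactors, ((freyCurve a b).minimalDiscriminantNorm ℤ).factorization q with hTdef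
  set r : ℕ := congruenceNumber D.f with hr
  have hcmp : ((ξ / (ordProj[2] ξ * ordProj[3] ξ) : ℕ) : ℝ) ≤
      C * (N : ℝ) ^ ε * ((r / (ordProj[2] r * ordProj[3] r) : ℕ) : ℝ) :=
    hC a b hab h0 N hN Nm hodd hsq hcard hNmN hξ D.f D.isNewformOf
  have hL6 : ((r / (ordProj[2] r * ordProj[3] r) : ℕ) : ℝ) ≤
      ((D.deg / (ordProj[2] D.deg * ordProj[3] D.deg) : ℕ) : ℝ) := by
    exact_mod_cast primeToSix_congruenceNumber_le_primeToSix_deg hARS hab h0 hN D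
  -- `1 ≤ T`, hence `1 ≤ T³`
  have hone : ∀ q ∈ N.primeFactors, 1 ≤ ((freyCurve a b).minimalDiscriminantNorm ℤ).factorization q :=
    fun q hq => factorization_minimalDiscriminantNorm_pos_of_dvd (freyCurve a b)
      (Nat.prime_of_mem_primeFactors hq) (hN ▸ Nat.dvd_of_mem_primeFactors hq)
  have hT1 : (1 : ℝ) ≤ (T : ℝ) := by
    have : 1 ≤ T := Finset.one_le_prod' fun q hq => hone q hq
    exact_mod_cast this
  have hT3 : (1 : ℝ) ≤ (T : ℝ) ^ 3 := one_le_pow₀ hT1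
  have hNε : (0 : ℝ) ≤ (N : ℝ) ^ ε := by positivity
  calc ((ξ / (ordProj[2] ξ * ordProj[3] ξ) : ℕ) : ℝ)
      ≤ C * (N : ℝ) ^ ε * ((r / (ordProj[2] r * ordProj[3] r) : ℕ) : ℝ) := hcmp
    _ ≤ max C 0 * (N : ℝ) ^ ε * ((r / (ordProj[2] r * ordProj[3] r) : ℕ) : ℝ) := by
        have h0' : (0 : ℝ) ≤ (N : ℝ) ^ ε * ((r / (ordProj[2] r * ordProj[3] r) : ℕ) : ℝ) := by positivity
        calc C * (N : ℝ) ^ ε * ((r / (ordProj[2] r * ordProj[3] r) : ℕ) : ℝ)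
            = C * ((N : ℝ) ^ ε * ((r / (ordProj[2] r * ordProj[3] r) : ℕ) : ℝ)) := by ring
          _ ≤ max C 0 * ((N : ℝ) ^ ε * ((r / (ordProj[2] r * ordProj[3] r) : ℕ) : ℝ)) :=
              mul_le_mul_of_nonneg_right (le_max_left _ _) h0'
          _ = _ := by ring
    _ ≤ max C 0 * (N : ℝ) ^ ε * ((D.deg / (ordProj[2] D.deg * ordProj[3] D.deg) : ℕ) : ℝ) := by gcongr
    _ = max C 0 * (N : ℝ) ^ ε * ((D.deg / (ordProj[2] D.deg * ordProj[3] D.deg) : ℕ) : ℝ) * 1 := by ring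
    _ ≤ max C 0 * (N : ℝ) ^ ε * ((D.deg / (ordProj[2] D.deg * ordProj[3] D.deg) : ℕ) : ℝ) * (T : ℝ) ^ 3 := by
        gcongr

end Summit.ABC.ABC.Cruxes.SteinbergCore.StubIdeasK1G11

end
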